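import Summits.QuantumFields.YangMills.Theorems.BalabanUVNodesN21AvgKernelEquivarianceTower

/-!
# N21 (NE7c) · infrastructure, III: the PERFORMED DENSITY `T4AveragingDisintegration.perfDensity ν F Tr μ` (the window presentation's «old
# integrations performed», §6) along a measure-preserving intertwining pair — `perfDensity ν F Tr μ (S a) = perfDensity ν (F ∘ T) Tr μ a` for `μ`-a.e. `a`;
# instance: COARSE GAUGE COVARIANCE of the performed density of the `k`-step tower, and its INVARIANCE for lift-invariant weights

Track A of `YM-PLAN.md` (cell `pub-ymgap`, HUMAN RULING D-0062 ∕ D-0149 width seats), node **N21**; WIDTH SEAT `pub-ymgap-dag-n21-w2` (gen 2), file 16.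
THEOREMS ONLY: 0 `def`, 0 `sorry`; COUNT-NEUTRAL; `--kind proof --supports stmt-QuantumFields-20544 --as helper`.  Imports ONLY my file 12 `…N21AvgKernelEquivarianceTower`
(p606348: `towerMap_gaugeAct`; → p605176 `map_avg_map_eq`; → `T4AveragingDisintegration` (`perfDensity`, `towerMap`, `measurable_towerMap`), `B12RTGaugeInvariance254`,
`T4ShellMeasureDet` (`withDensity_map_eq_map_withDensity_comp`)).  NO Theses import.  Restates nothing; cites by name.

WHY.  `T4AveragingDisintegration` §6 (design (W), the cell referee's reading F6 (c)) types a run's OLD integrations as PERFORMED: the remainder sandwich lives on the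
window space and every older level enters as the value `perfDensity ν F Tr μ` — the Radon–Nikodym density of the image under the old tower map `Tr` of the weighted
finest-level measure `F⁺ · ν`.  Files 10 ∕ 12 gave the kernel ∕ marginal-density ∕ kernel-transport equivariance along an intertwining pair; this file gives the same for
the performed density, so that a gauge transformation of the window variable is absorbed into the weight (and disappears for gauge-invariant weights).

WHAT IS PROVED ([folklore]: change of variables under a density + `MeasurableEmbedding.rnDeriv_map` at the equivalence `S`).
* §1 GENERIC (`T : β → β` measurable with `ν.map T = ν`, `S : α ≃ᵐ α` with `μ.map S = μ`, `Tr ∘ T = S ∘ Tr`, `F` measurable with `F ∘ T` `ν`-integrable):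
  `map_withDensity_ofReal_comp` (`(ν.withDensity (F ∘ T)⁺).map T = ν.withDensity F⁺`) · `map_map_withDensity_comp_eq` (`((ν.withDensity (F∘T)⁺).map Tr).map S = (ν.withDensity F⁺).map Tr`) ·
  ★ `perfDensity_comp_ae_eq` : `∀ᵐ a ∂μ, perfDensity ν F Tr μ (S a) = perfDensity ν (F ∘ T) Tr μ a` · `perfDensity_comp_ae_eq_of_invariant` (`F ∘ T = F` ⇒ `perfDensity (S a) = perfDensity a` a.e.).
* §2 GAUGE FIELDS, the `k`-step tower (`Tr := towerMap (fun i => (av i).avg) lvl k`, coherent lifts `u`, `T := (·)^{u 0}`, `S := (·)^{u k}`, `μ := dV` on level `lvl + k`):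
  ★ `perfDensity_towerMap_gaugeAct_ae_eq` (covariance for EVERY measurable weight with `F ∘ (·)^{u 0}` integrable) · `perfDensity_towerMap_gaugeAct_ae_eq_of_invariant`
  (a weight invariant under `(·)^{u 0}` has a coarse-gauge-invariant performed density, `dV`-a.e.).

HONEST FRAMING.  [folklore] bookkeeping; the coherent family is consumer DATA; transitivity NOT claimed; nothing of Bałaban's asserted; (M1) ∕ NE7c NOT PRINTED ∕ NOT proved;
**N21 NOT discharged**; K3⁷ NOT claimed; counts UNMOVED (typed 28∕28 · discharged 5∕27); one finite four-torus programme at fixed `ε` — NOT ℝ⁴, NOT infinite volume, NOT OS,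
NOT a mass gap, NOT Clay.  No decl below carries a cite tag.
-/

noncomputable section

open MeasureTheory ProbabilityTheory
open scoped ENNReal

namespace Summit.QuantumFields.YangMills.Theorems.N21AvgKernelEquivariance

open Literature.MathematicalPhysics.QuantumFieldTheory.Balaban1983to89
open T4AveragingDisintegration (perfDensity towerMap measurable_towerMap)
open T4ShellMeasureDet (withDensity_map_eq_map_withDensity_comp)
open B12RTGaugeInvariance254 (invTransf liftTransf gaugeAct_inv_gaugeAct gaugeAct_gaugeAct_inv measurable_gaugeAct measurePreserving_gaugeAct)

/-! ## §1 Generic: the performed density along a measure-preserving intertwining pair -/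

section Generic

variable {α β : Type*} [MeasurableSpace α] [MeasurableSpace β]

/-- Change of variables under the density: `(ν.withDensity (F ∘ T)⁺).map T = ν.withDensity F⁺` when `ν.map T = ν`
(`T4ShellMeasureDet.withDensity_map_eq_map_withDensity_comp`). [folklore] -/
theorem map_withDensity_ofReal_comp (ν : Measure β) {T : β → β} (hT : Measurable T) (hν : ν.map T = ν)
    {F : β → ℝ} (hF : Measurable F) :
    (ν.withDensity fun w => ENNReal.ofReal (F (T w))).map T = ν.withDensity fun w => ENNReal.ofReal (F w) := by
  have h := withDensity_map_eq_map_withDensity_comp (μ := ν) hT (G := fun w => ENNReal.ofReal (F w))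
    (ENNReal.measurable_ofReal.comp hF)
  rw [hν] at h
  exact h.symm

/-- The image of the `(F ∘ T)`-weighted measure under `Tr`, pushed by `S`, IS the image of the `F`-weighted measure under `Tr` (`Tr ∘ T = S ∘ Tr`). [folklore] -/
theorem map_map_withDensity_comp_eq (ν : Measure β) {Tr : β → α} (hTr : Measurable Tr) {T : β → β} (hT : Measurable T)
    {S : α → α} (hS : Measurable S) (hST : ∀ w, Tr (T w) = S (Tr w)) (hν : ν.map T = ν) {F : β → ℝ} (hF : Measurable F) :
    ((ν.withDensity fun w => ENNReal.ofReal (F (T w))).map Tr).map S = (ν.withDensity fun w => ENNReal.ofReal (F w)).map Tr := by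
  rw [Measure.map_map hS hTr]
  have h : S ∘ Tr = Tr ∘ T := funext fun w => (hST w).symm
  rw [h, ← Measure.map_map hTr hT, map_withDensity_ofReal_comp ν hT hν hF]

/-- ★ **THE PERFORMED DENSITY ALONG THE PAIR**: for `μ`-almost every window point `a`, `perfDensity ν F Tr μ (S a) = perfDensity ν (F ∘ T) Tr μ a`
(`F` measurable with `F ∘ T` `ν`-integrable, `μ` σ-finite and `S`-invariant; Mathlib `MeasurableEmbedding.rnDeriv_map` at `S`). [folklore] -/
theorem perfDensity_comp_ae_eq (ν : Measure β) (μ : Measure α) [SigmaFinite μ] {Tr : β → α} (hTr : Measurable Tr)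
    {T : β → β} (hT : Measurable T) (S : α ≃ᵐ α) (hST : ∀ w, Tr (T w) = S (Tr w)) (hν : ν.map T = ν) (hμS : μ.map S = μ)
    {F : β → ℝ} (hF : Measurable F) (hFT : Integrable (fun w => F (T w)) ν) :
    ∀ᵐ a ∂μ, perfDensity ν F Tr μ (S a) = perfDensity ν (fun w => F (T w)) Tr μ a := by
  haveI : IsFiniteMeasure (ν.withDensity fun w => ENNReal.ofReal (F (T w))) := isFiniteMeasure_withDensity_ofReal hFT.2
  have h := S.measurableEmbedding.rnDeriv_map ((ν.withDensity fun w => ENNReal.ofReal (F (T w))).map Tr) μ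
  rw [hμS, map_map_withDensity_comp_eq ν hTr hT S.measurable hST hν hF] at h
  filter_upwards [h] with a ha
  unfold perfDensity T4TermReprCoupling.rnNN
  rw [ha]

/-- COROLLARY: a weight invariant under `T` has an `S`-invariant performed density, `μ`-a.e. [folklore] -/
theorem perfDensity_comp_ae_eq_of_invariant (ν : Measure β) (μ : Measure α) [SigmaFinite μ] {Tr : β → α} (hTr : Measurable Tr)
    {T : β → β} (hT : Measurable T) (S : α ≃ᵐ α) (hST : ∀ w, Tr (T w) = S (Tr w)) (hν : ν.map T = ν) (hμS : μ.map S = μ)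
    {F : β → ℝ} (hF : Measurable F) (hFi : Integrable F ν) (hinv : ∀ w, F (T w) = F w) :
    ∀ᵐ a ∂μ, perfDensity ν F Tr μ (S a) = perfDensity ν F Tr μ a := by
  have hFT : Integrable (fun w => F (T w)) ν := by simpa only [hinv] using hFi
  filter_upwards [perfDensity_comp_ae_eq ν μ hTr hT S hST hν hμS hF hFT] with a ha
  rw [ha]
  simp only [hinv]

end Generic

/-! ## §2 Gauge fields: the performed density of the `k`-step tower under coarse gauge transformations -/

section Tower

variable {P : Params} {G : Type*} [GaugeGroup G] [MeasurableSpace G] [HaarData G] [MeasurableMul₂ G]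

/-- ★ **COVARIANCE OF THE TOWER's PERFORMED DENSITY**: for covariant averagings of the standing range, a coherent lift family `u` and a measurable weight `F` on level
`lvl` with `F ∘ (·)^{u 0}` `dU`-integrable, for `dV`-a.e. `V` on level `lvl + k`,
`perfDensity dU F towerMap dV (V^{u k}) = perfDensity dU (F ∘ (·)^{u 0}) towerMap dV V`. [folklore] -/
theorem perfDensity_towerMap_gaugeAct_ae_eq (av : (i : ℕ) → Averaging P i G) (havg : ∀ i, Measurable (av i).avg) (lvl k : ℕ)
    (hr : lvl + k ≤ P.m + P.K) (u : (i : ℕ) → GaugeTransf P (lvl + i) G) (hu : ∀ i, i < k → u i = liftTransf (j := lvl + i) (u (i + 1)))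
    {F : GaugeField P lvl G → ℝ} (hF : Measurable F) (hFT : Integrable (fun U => F (GaugeField.gaugeAct (u 0) U)) (fieldMeasure P lvl G)) :
    ∀ᵐ V ∂(fieldMeasure P (lvl + k) G),
      perfDensity (fieldMeasure P lvl G) F (towerMap (fun i => (av i).avg) lvl k) (fieldMeasure P (lvl + k) G) (GaugeField.gaugeAct (u k) V)
        = perfDensity (fieldMeasure P lvl G) (fun U => F (GaugeField.gaugeAct (u 0) U)) (towerMap (fun i => (av i).avg) lvl k)
            (fieldMeasure P (lvl + k) G) V := by
  let S : GaugeField P (lvl + k) G ≃ᵐ GaugeField P (lvl + k) G :=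
    { toFun := GaugeField.gaugeAct (u k)
      invFun := GaugeField.gaugeAct (invTransf (u k))
      left_inv := gaugeAct_inv_gaugeAct (u k)
      right_inv := gaugeAct_gaugeAct_inv (u k)
      measurable_toFun := measurable_gaugeAct (u k)
      measurable_invFun := measurable_gaugeAct (invTransf (u k)) }
  exact perfDensity_comp_ae_eq (fieldMeasure P lvl G) (fieldMeasure P (lvl + k) G) (measurable_towerMap _ havg lvl k)
    (measurable_gaugeAct (u 0)) S (towerMap_gaugeAct av lvl k hr u hu) (measurePreserving_gaugeAct (u 0)).map_eq
    (measurePreserving_gaugeAct (u k)).map_eq hF hFT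

/-- COROLLARY: a `dU`-integrable weight INVARIANT under `(·)^{u 0}` has a coarse-gauge-invariant performed density on level `lvl + k`, `dV`-a.e. [folklore] -/
theorem perfDensity_towerMap_gaugeAct_ae_eq_of_invariant (av : (i : ℕ) → Averaging P i G) (havg : ∀ i, Measurable (av i).avg) (lvl k : ℕ)
    (hr : lvl + k ≤ P.m + P.K) (u : (i : ℕ) → GaugeTransf P (lvl + i) G) (hu : ∀ i, i < k → u i = liftTransf (j := lvl + i) (u (i + 1)))
    {F : GaugeField P lvl G → ℝ} (hF : Measurable F) (hFi : Integrable F (fieldMeasure P lvl G))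
    (hinv : ∀ U, F (GaugeField.gaugeAct (u 0) U) = F U) :
    ∀ᵐ V ∂(fieldMeasure P (lvl + k) G),
      perfDensity (fieldMeasure P lvl G) F (towerMap (fun i => (av i).avg) lvl k) (fieldMeasure P (lvl + k) G) (GaugeField.gaugeAct (u k) V)
        = perfDensity (fieldMeasure P lvl G) F (towerMap (fun i => (av i).avg) lvl k) (fieldMeasure P (lvl + k) G) V := by
  let S : GaugeField P (lvl + k) G ≃ᵐ GaugeField P (lvl + k) G :=
    { toFun := GaugeField.gaugeAct (u k)
      invFun := GaugeField.gaugeAct (invTransf (u k))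
      left_inv := gaugeAct_inv_gaugeAct (u k)
      right_inv := gaugeAct_gaugeAct_inv (u k)
      measurable_toFun := measurable_gaugeAct (u k)
      measurable_invFun := measurable_gaugeAct (invTransf (u k)) }
  exact perfDensity_comp_ae_eq_of_invariant (fieldMeasure P lvl G) (fieldMeasure P (lvl + k) G) (measurable_towerMap _ havg lvl k)
    (measurable_gaugeAct (u 0)) S (towerMap_gaugeAct av lvl k hr u hu) (measurePreserving_gaugeAct (u 0)).map_eq
    (measurePreserving_gaugeAct (u k)).map_eq hF hFi hinv

end Tower

end Summit.QuantumFields.YangMills.Theorems.N21AvgKernelEquivariance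

end
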